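import Summits.HubbardSuperconductivity.HubbardSuperconductivity.Theses.JosephsonMirror

/-!
# Sketch — crux stmt-HubbardSuperconductivity-2227 (`JosephsonMirror.JmInterchange`), crux-ideate round 1, ideator 1

Typed first lemmas for the idea card `strip-the-mirror-pair-removal-bridge` (this folder,
`idea-strip-the-mirror-pair-removal-bridge.md`). Nothing here is an item; `sorry`-free; the two
theorems are pure logic (bookkeeping that the decomposition concludes the crux BY NAME).

§1  NORMAL FORM.  `GainHyp` / `FloorBridge` are the hypothesis / conclusion of `JmInterchange`
    verbatim (`jmInterchange_iff_pointwise` is `Iff.rfl`).  `ZeroExcessPairOrder U δ` (ZEPO) is the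
    single-layer, source-free, window-free statement "eventually in even `L` some unit vector of
    sector `N_L` or `N_L - 2` (`S^z = 0`) lies within `εL²` of its sector floor and has `d`-wave pair
    intensity `≥ cL⁴`".  `HypGivesZEPO` (Schmidt–pigeonhole on the PSD minimiser of the reflection-
    positive double; provable now) and `ZEPOGivesHyp` (pair-removed product trial state; provable
    now) make `JmInterchange ↔ SingleLayerForm` (`jmInterchange_iff_singleLayer`, logic).
§2  RESIDUES.  `ZeroExcessOrderReachesFloor` (KT core: zero-excess order ⇒ ground-FLOOR order; the
    one stub that carries the crux's `∀ (U, δ)` exposure), `LowLyingOrthogonality` +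
    `ChargingFloor` (the two `O(γ_L)`-scale inputs of the bridge), `PairRemovalExcessBound` (the
    pair-removal double commutator, provable now), `BridgeFromFloorOrder` (the engine: floor order
    ⇒ adjacent-floor bridge by spectral Markov; provable now), and the composition
    `jmInterchange_of` (logic).
-/

set_option linter.dupNamespace false

namespace Summit.HubbardSuperconductivity.HubbardSuperconductivity.Cruxes.JmInterchange.Ideator1

open Literature.MathematicalPhysics.QuantumLattice Filter
open scoped Matrix
open Summit.HubbardSuperconductivity.HubbardSuperconductivity.Theses.JosephsonMirror (JmInterchange)

noncomputable section

/-- The summit's particle number `N_L = 2⌊(1-δ)L²/2⌋`. -/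
def statN (δ : ℝ) (L : ℕ) : ℕ := 2 * ⌊(1 - δ) * (L : ℝ) ^ 2 / 2⌋₊

/-! ## §1 Normal form: the mirror, the window, `μ_L` and `J` are eliminable -/

/-- The HYPOTHESIS of `JmInterchange` at `(U, δ, a, J₀)`, verbatim: uniform linear Josephson gain of
the window double, `∀ J ∈ (0, J₀] ∃ L₀ ∀ even L ≥ L₀, a·J·L² ≤ E_L(0) - E_L(J)`. -/
def GainHyp (U δ a J₀ : ℝ) : Prop :=
  ∀ J ∈ Set.Ioc (0:ℝ) J₀, ∃ L₀ : ℕ, ∀ (L : ℕ) [NeZero L], Even L → L₀ ≤ L → (let ι : Type := Finset (Literature.MathematicalPhysics.QuantumLattice.Orb (Literature.MathematicalPhysics.QuantumLattice.FermionTorus 2 L)); let N : ℕ := 2 * ⌊(1 - δ) * (L : ℝ) ^ 2 / 2⌋₊; let H : Matrix ι ι ℂ := Literature.MathematicalPhysics.QuantumLattice.hubbardTorus 2 L 1 U; let μ : ℝ := (H.minEnergyOn (Literature.MathematicalPhysics.QuantumLattice.szSector N 0) - H.minEnergyOn (Literature.MathematicalPhysics.QuantumLattice.szSector (N - 2) 0))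 / 2; let A : Matrix ι ι ℂ := Literature.MathematicalPhysics.QuantumLattice.hubbardTorusWith 2 L 1 U μ; let D : Matrix ι ι ℂ := ((L : ℂ))⁻¹ • Literature.MathematicalPhysics.QuantumLattice.pairField Literature.MathematicalPhysics.QuantumLattice.dWaveFormFactor L; let Hd : ℝ → Matrix (ι × ι) (ι × ι) ℂ := fun J => Matrix.kroneckerMap (fun a b : ℂ => a * b) A 1 + Matrix.kroneckerMap (fun a b : ℂ => a * b) 1 (Matrix.transpose A) - (J : ℂ) • (Matrix.kroneckerMap (fun a b : ℂ => a * b) D (Matrix.transpose (Matrix.conjTranspose D)) + Matrix.kroneckerMap (fun a b : ℂ => a * b) (Matrix.conjTranspose D) (Matrix.transpose D)); let good : ι × ι → Prop := fun p => ((p.1.card = N ∧ p.2.card = N) ∨ (p.1.card = N - 2 ∧ p.2.card = N - 2)) ∧ (p.1.filter (fun o => (ofLex o).2 = 0)).card = (p.1.filter (fun o => (ofLex o).2 = 1)).card ∧ (p.2.filter (fun o => (ofLex o).2 = 0)).card = (p.2.filter (fun o => (ofLex o).2 = 1)).card; let S : Submodule ℂ (ι × ι → ℂ) := ⨅ (p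 : ι × ι) (_ : ¬ good p), LinearMap.ker (LinearMap.proj (R := ℂ) (φ := fun _ : ι × ι => ℂ) p); let E : ℝ → ℝ := fun J => (Hd J).minEnergyOn S; a * J * (L : ℝ) ^ 2 ≤ E 0 - E J)

/-- The CONCLUSION of `JmInterchange` at `(U, δ)`, verbatim: an eventual ground-floor pair bridge
`|⟨χ, Δ_d φ⟩|² ≥ a′L⁴` between the sectors `(N_L, 0)` and `(N_L - 2, 0)`. -/
def FloorBridge (U δ : ℝ) : Prop :=
  ∃ a' : ℝ, 0 < a' ∧ ∃ L₀ : ℕ, ∀ (L : ℕ) [NeZero L], Even L → L₀ ≤ L → ∃ φ χ : Literature.MathematicalPhysics.QuantumLattice.Fock (Literature.MathematicalPhysics.QuantumLattice.Orb (Literature.MathematicalPhysics.QuantumLattice.FermionTorus 2 L)), Literature.MathematicalPhysics.QuantumLattice.IsGroundStateInSector (Literature.MathematicalPhysics.QuantumLattice.hubbardTorus 2 L 1 U) (2 * ⌊(1 - δ) * (L : ℝ) ^ 2 / 2⌋₊) 0 φ ∧ star φ ⬝ᵥ φ = 1 ∧ Literature.MathematicalPhysics.QuantumLattice.IsGroundStateInSector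 (Literature.MathematicalPhysics.QuantumLattice.hubbardTorus 2 L 1 U) (2 * ⌊(1 - δ) * (L : ℝ) ^ 2 / 2⌋₊ - 2) 0 χ ∧ star χ ⬝ᵥ χ = 1 ∧ a' * (L : ℝ) ^ 4 ≤ ‖star χ ⬝ᵥ Matrix.mulVec (Literature.MathematicalPhysics.QuantumLattice.pairField Literature.MathematicalPhysics.QuantumLattice.dWaveFormFactor L) φ‖ ^ 2

/-- The crux IS `∀ (U, δ, a, J₀), GainHyp → FloorBridge` (definitional). -/
theorem jmInterchange_iff_pointwise :
    JmInterchange ↔ ∀ (U δ a J₀ : ℝ), 0 < U → δ ∈ Set.Ioo (0:ℝ) (1 / 2) → 0 < a → 0 < J₀ →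
      GainHyp U δ a J₀ → FloorBridge U δ :=
  Iff.rfl

/-- ZERO-EXCESS PAIR ORDER at `(U, δ)` (single layer, source-free, no double): some `c > 0` such
that for every `ε > 0`, eventually in even `L`, a unit vector `v` of sector `N_L` or `N_L - 2`
(`S^z = 0`) has energy `≤ e_L(n) + εL²` and `‖Δ_d v‖² ≥ cL⁴`. -/
def ZeroExcessPairOrder (U δ : ℝ) : Prop :=
  ∃ c : ℝ, 0 < c ∧ ∀ ε : ℝ, 0 < ε → ∃ L₀ : ℕ, ∀ (L : ℕ) [NeZero L], Even L → L₀ ≤ L →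
    ∃ n : ℕ, (n = statN δ L ∨ n = statN δ L - 2) ∧
      ∃ v : Fock (Orb (FermionTorus 2 L)), v ∈ szSector n 0 ∧ star v ⬝ᵥ v = 1 ∧
        (star v ⬝ᵥ (hubbardTorus 2 L 1 U *ᵥ v)).re ≤
            (hubbardTorus 2 L 1 U).minEnergyOn (szSector n 0) + ε * (L : ℝ) ^ 2 ∧
        c * (L : ℝ) ^ 4 ≤
          (star (pairField dWaveFormFactor L *ᵥ v) ⬝ᵥ (pairField dWaveFormFactor L *ᵥ v)).re

/-- FORWARD HALF (provable now): gain ⇒ zero-excess pair order.  For `L ≥ L₀(J)` take the PSD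
minimiser `ψ_J ↔ W = Σ λ_i v_i v_iᴴ` of the window problem (item 2230 `JmPositiveMinimiser`,
PROVED); Feynman–Hellmann (`sub_le_of_isMinimiser`) gives `⟨K⟩ ≥ aL²`, the energy identity gives
`Σ λ_i² exc(v_i) ≤ J‖K‖/2 ≤ CJL²`; `⟨K⟩ = 2Σλ_iλ_j|⟨v_i, Dv_j⟩|² ≤ Σλ_i²(‖Dv_i‖² + ‖Dᴴv_i‖²)`
(AM–GM + Bessel; a POSITIVE sum because `W ⪰ 0`), so Markov over the law `λ_i²` yields one sector
vector with `‖Δ_d v‖² ≥ (a/4)L⁴` and `exc ≤ C′JL²/a`; finally `J := J(ε)` small. -/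
def HypGivesZEPO : Prop :=
  ∀ (U δ a J₀ : ℝ), 0 < U → δ ∈ Set.Ioo (0:ℝ) (1 / 2) → 0 < a → 0 < J₀ →
    GainHyp U δ a J₀ → ZeroExcessPairOrder U δ

/-- BACKWARD HALF (provable now; refuter pass-4 of item 2227): zero-excess pair order ⇒ gain, via the
window trial state `(v ⊗ v̄ + β ⊗ β̄)/√2`, `β = Δ_d v/‖Δ_d v‖` (or `Δ_dᴴ v` when `v` sits in
`N_L - 2`), `E_L(0) = 2(e(N_L) - μ_L N_L)` exactly by the balancing `μ_L`, and
`exc(β) ≤ exc(v) + O(1)`. -/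
def ZEPOGivesHyp : Prop :=
  ∀ (U δ : ℝ), 0 < U → δ ∈ Set.Ioo (0:ℝ) (1 / 2) → ZeroExcessPairOrder U δ →
    ∃ a J₀ : ℝ, 0 < a ∧ 0 < J₀ ∧ GainHyp U δ a J₀

/-- The SINGLE-LAYER FORM of the crux: zero-excess pair order ⇒ ground-floor pair bridge, at
every `(U, δ)`. -/
def SingleLayerForm : Prop :=
  ∀ (U δ : ℝ), 0 < U → δ ∈ Set.Ioo (0:ℝ) (1 / 2) → ZeroExcessPairOrder U δ → FloorBridge U δ

/-- NORMAL FORM (logic, given the two provable halves): the mirror is eliminable. -/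
theorem jmInterchange_iff_singleLayer (h₁ : HypGivesZEPO) (h₂ : ZEPOGivesHyp) :
    JmInterchange ↔ SingleLayerForm := by
  rw [jmInterchange_iff_pointwise]
  constructor
  · intro h U δ hU hδ hZ
    obtain ⟨a, J₀, ha, hJ₀, hG⟩ := h₂ U δ hU hδ hZ
    exact h U δ a J₀ hU hδ ha hJ₀ hG
  · intro h U δ a J₀ hU hδ ha hJ₀ hG
    exact h U δ hU hδ (h₁ U δ a J₀ hU hδ ha hJ₀ hG)

/-! ## §2 Residues and the bridge engine -/

/-- GROUND-FLOOR ORDER at `(U, δ)`: eventually in even `L` SOME unit ground state of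
`(N_L, S^z = 0)` has `‖Δ_d g‖² ≥ cL⁴`. -/
def FloorOrder (U δ : ℝ) : Prop :=
  ∃ c : ℝ, 0 < c ∧ ∃ L₀ : ℕ, ∀ (L : ℕ) [NeZero L], Even L → L₀ ≤ L →
    ∃ g : Fock (Orb (FermionTorus 2 L)), IsGroundStateInSector (hubbardTorus 2 L 1 U) (statN δ L) 0 g ∧
      star g ⬝ᵥ g = 1 ∧
      c * (L : ℝ) ^ 4 ≤
        (star (pairField dWaveFormFactor L *ᵥ g) ⬝ᵥ (pairField dWaveFormFactor L *ᵥ g)).re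

/-- THE EXPOSED STUB (Koma–Tasaki core, residues R1 face purity + R2 infrared leak): zero-excess
pair order reaches the ground floor.  False at any iso-density first-order level crossing between an
order-rich and an order-poor phase where the order-poor phase wins the torus floor infinitely often
(refuter pass-4 (c) on item 2227); the crux as typed is hostage to exactly the same points. -/
def ZeroExcessOrderReachesFloor : Prop :=
  ∀ (U δ : ℝ), 0 < U → δ ∈ Set.Ioo (0:ℝ) (1 / 2) → ZeroExcessPairOrder U δ → FloorOrder U δ

/-- BRIDGE INPUT 1 (scale `γ_L`): the low-lying window `(e(N_L-2), e(N_L-2) + γ_L)` of sector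
`(N_L - 2, 0)` is ORTHOGONAL to `Δ_d G(N_L)` — e.g. because every eigenvector there carries quantum
numbers (momentum, `C₄` character, total spin) different from those of `Δ_d g`. -/
def LowLyingOrthogonality (U δ : ℝ) (γ : ℕ → ℝ) : Prop :=
  ∃ L₀ : ℕ, ∀ (L : ℕ) [NeZero L], Even L → L₀ ≤ L →
    ∀ g : Fock (Orb (FermionTorus 2 L)), IsGroundStateInSector (hubbardTorus 2 L 1 U) (statN δ L) 0 g →
      ∀ (w : Fock (Orb (FermionTorus 2 L))) (E : ℝ), w ∈ szSector (statN δ L - 2) 0 →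
        hubbardTorus 2 L 1 U *ᵥ w = (E : ℂ) • w →
        (hubbardTorus 2 L 1 U).minEnergyOn (szSector (statN δ L - 2) 0) < E →
        E < (hubbardTorus 2 L 1 U).minEnergyOn (szSector (statN δ L - 2) 0) + γ L →
          star w ⬝ᵥ (pairField dWaveFormFactor L *ᵥ g) = 0

/-- BRIDGE INPUT 2 (scale `γ_L`): no pair-binding concavity of the even-sector floor energies at
`N_L` beyond `o(γ_L)`: `2e(N_L) - e(N_L+2) - e(N_L-2) ≤ εγ_L` eventually (finite charging energy /
stability; the opposite inequality `D²e(N_L) ≤ C/(ΛL²)` is automatic from floor order). -/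
def ChargingFloor (U δ : ℝ) (γ : ℕ → ℝ) : Prop :=
  ∀ ε : ℝ, 0 < ε → ∃ L₀ : ℕ, ∀ (L : ℕ), Even L → L₀ ≤ L →
    (let e : ℕ → ℝ := fun n => (hubbardTorus 2 L 1 U).minEnergyOn (szSector n 0)
     let N : ℕ := statN δ L
     2 * e N - e (N + 2) - e (N - 2) ≤ ε * γ L)

/-- THE LEVER (pair-removal double commutator; provable now, ~600 lines): for every eigenvector `g`
of `H = hubbardTorus 2 L 1 U` in a sector, with `Δ = Δ_d`,
`[re⟨Δg, HΔg⟩ - E‖Δg‖²] + [re⟨Δᴴg, HΔᴴg⟩ - E‖Δᴴg‖²] = re⟨g, [Δᴴ, [H, Δ]] g⟩ ≤ C(1+U)L²‖g‖²`,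
because `[Δᴴ, [H, Δ]]` is a sum of `O(L²)` uniformly bounded local terms (Horsch–von der Linden /
Koma–Tasaki Thm 2.2 double commutator, here kept two-sided and sector-resolved). -/
def PairRemovalExcessBound : Prop :=
  ∃ C : ℝ, 0 < C ∧ ∀ (L : ℕ) [NeZero L] (U : ℝ) (N : ℕ) (E : ℝ) (g : Fock (Orb (FermionTorus 2 L))),
    0 ≤ U → g ∈ szSector N 0 → hubbardTorus 2 L 1 U *ᵥ g = (E : ℂ) • g →
      (let H := hubbardTorus 2 L 1 U
       let Δ := pairField dWaveFormFactor L
       ((star (Δ *ᵥ g) ⬝ᵥ (H *ᵥ (Δ *ᵥ g))).re - E * (star (Δ *ᵥ g) ⬝ᵥ (Δ *ᵥ g)).re) +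
         ((star (Δᴴ *ᵥ g) ⬝ᵥ (H *ᵥ (Δᴴ *ᵥ g))).re - E * (star (Δᴴ *ᵥ g) ⬝ᵥ (Δᴴ *ᵥ g)).re) ≤
           C * (1 + U) * (L : ℝ) ^ 2 * (star g ⬝ᵥ g).re)

/-- THE ENGINE (provable now from `PairRemovalExcessBound` + spectral Markov, ~800 lines): floor
order ⇒ adjacent-floor bridge.  For a unit floor state `g` with `‖Δg‖² = ΛL⁴`: the variational
floors in sectors `N_L ± 2` turn the double-commutator bound into
`exc(Δg over e(N_L-2)) ≤ C(1+U)/(ΛL²)·‖Δg‖²·L⁻²… ≤ [C(1+U)L² + (2e(N)-e(N+2)-e(N-2))₊ΛL⁴ + O(L²)]`;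
expanding `Δg` in eigenvectors of `H` on the sector, the window `(e, e+γ_L)` carries no weight
(input 1) and the part above `e + γ_L` has weight `≤ exc/γ_L`; with `γ_L L² → ∞` and input 2 the
ground-space component `P_G Δg` keeps `≥ ½‖Δg‖²`, and `χ := P_G Δg/‖P_G Δg‖` is the bridge partner:
`|⟨χ, Δ_d g⟩|² = ‖P_G Δg‖² ≥ (Λ/2)L⁴`. -/
def BridgeFromFloorOrder : Prop :=
  ∀ (U δ : ℝ), 0 < U → δ ∈ Set.Ioo (0:ℝ) (1 / 2) → ∀ γ : ℕ → ℝ,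
    Tendsto (fun L : ℕ => γ L * (L : ℝ) ^ 2) atTop atTop →
    LowLyingOrthogonality U δ γ → ChargingFloor U δ γ → FloorOrder U δ → FloorBridge U δ

/-- The bridge inputs at SOME admissible scale `γ_L` with `γ_L L² → ∞` (expected: `γ_L ≍ L⁻¹`,
two sound quanta / two nodal quasiparticles; hazard: near-commensurate `L` for the nodes). -/
def SymmetricWindowInputs : Prop :=
  ∀ (U δ : ℝ), 0 < U → δ ∈ Set.Ioo (0:ℝ) (1 / 2) → FloorOrder U δ →
    ∃ γ : ℕ → ℝ, Tendsto (fun L : ℕ => γ L * (L : ℝ) ^ 2) atTop atTop ∧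
      LowLyingOrthogonality U δ γ ∧ ChargingFloor U δ γ

/-- COMPOSITION (logic): the four pieces conclude the crux BY NAME. -/
theorem jmInterchange_of (h₁ : HypGivesZEPO) (h₂ : ZeroExcessOrderReachesFloor)
    (h₃ : SymmetricWindowInputs) (h₄ : BridgeFromFloorOrder) : JmInterchange := by
  rw [jmInterchange_iff_pointwise]
  intro U δ a J₀ hU hδ ha hJ₀ hG
  have hF : FloorOrder U δ := h₂ U δ hU hδ (h₁ U δ a J₀ hU hδ ha hJ₀ hG)
  obtain ⟨γ, hγ, hlow, hch⟩ := h₃ U δ hU hδ hF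
  exact h₄ U δ hU hδ γ hγ hlow hch hF

end

end Summit.HubbardSuperconductivity.HubbardSuperconductivity.Cruxes.JmInterchange.Ideator1
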